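import Summits.KontsevichZagierPeriods.KontsevichZagierPeriods.Theses.StandardParts
import Summits.KontsevichZagierPeriods.KontsevichZagierPeriods.Theorems.StandardPartsSpArcLiftingRawArcs
import Literature.NumberTheory.Transcendental.KZTameMoveFamily
import Literature.NumberTheory.Transcendental.KZVolumeConjectureProofs
import Literature.NumberTheory.Transcendental.KZKernelConjectureForms

/-!
# Route StandardParts — item `SpArcLiftingOfPieces` (stmt-KontsevichZagierPeriods-18037): the split glue, BY NAME

Problem `KontsevichZagierPeriods`, route `StandardParts`. Closes the support item
stmt-KontsevichZagierPeriods-18037 `SpArcLiftingOfPieces : SpVolumeArcLifting → SpTameNoBlowUp →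
SpTameUniformClosure → SpArcLifting` — the assembly of the crux-strategist's BC2-redirect split of the
deciding crux `SpArcLifting` (stmt-3155, summit-equivalent as typed) into the three leaves
stmt-18034 `SpVolumeArcLifting` (arithmetic half on Cresson–Viu-Sos' compact volume forms),
stmt-18035 `SpTameNoBlowUp` (tame arcs of identities are uniform near `0⁺`) and stmt-18036
`SpTameUniformClosure` (tame uniform chains pass to the `L¹`-limit). Same proof as
`Cruxes/SpArcLifting/SplitGlue.lean` (`spArcLifting_of_pieces`), restated over the route decls.

Proof: the pieces give the volume form of Conjecture 1 (`volumeConjectureCompact_of_pieces'`: lift the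
equal-volume pair of compact bodies to a tame arc of identities by X₁, make it one tame uniform chain
on some `(0, δ)` by X₂, close at the `L¹`-endpoints by X₃ — tameness bounds merged by
`RawFamily.IsTame.mono` / `TameUniformChainOn.mono`); the volume form gives `KZPeriodConjecture'` by
Viu-Sos' semi-canonical reduction, DISCHARGED in the tree
(`KZ.kzPeriodConjecture'_of_volumeConjectureCompact`, `KZ.semiCanonicalReduction_holds`); that gives
the summit (`kzPeriodConjecture'_iff_isRational`), which gives `SpArcLifting` by constant typed arcs
(`spArcLifting_of_summit`, landed p143540).

Sources: M. Kontsevich, D. Zagier, *Periods* (2001), §1.2 Conjecture 1 [KontsevichZagier2001];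
J. Viu-Sos, IJNT 17 (2021), Thm. 1.1 [ViuSos2021]; J. Cresson, J. Viu-Sos, JTNB 34 (2022), §1 p. 326
[CressonViusos2022].
-/

noncomputable section

namespace Summit.KontsevichZagierPeriods.StandardParts

open Filter Set MeasureTheory Topology
open Literature.NumberTheory.Transcendental
open Summit.KontsevichZagierPeriods.KontsevichZagierPeriods.Theses.StandardParts
  (SpArcLifting SpVolumeArcLifting SpTameNoBlowUp SpTameUniformClosure SpArcLiftingOfPieces)

/-- The three leaves give the volume form of Conjecture 1 [Cresson–Viu-Sos 2022, §1 p. 326]: lift,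
uniformise, close (by name over the route decls). [cite: CressonViusos2022, §1 p. 326]
[cite: KontsevichZagier2001, §1.2 Conjecture 1] -/
theorem volumeConjectureCompact_of_pieces' (h₁ : SpVolumeArcLifting) (h₂ : SpTameNoBlowUp)
    (h₃ : SpTameUniformClosure) : KZ.volumeConjectureCompact := by
  intro d K K' hc hi hc' hi' h1 h1' hv
  obtain ⟨N, S, S', hS, hS', hid, hl, hl'⟩ := h₁ K K' hc hi hc' hi' h1 h1' hv
  obtain ⟨N', δ, hδ, huc⟩ := h₂ N S S' hS hS' hid
  exact h₃ (max N N') δ S S' K K' hδ (hS.mono (le_max_left N N')) (hS'.mono (le_max_left N N'))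
    (huc.mono subset_rfl (le_max_right N N')) hl hl'

/-- The three leaves give the summit: volume form (`volumeConjectureCompact_of_pieces'`) ⇒
`KZPeriodConjecture'` by the discharged Viu-Sos reduction ⇒ the `IsRational` form.
[cite: ViuSos2021, Thm. 1.1] [cite: CressonViusos2022, §1 p. 326] [cite: KontsevichZagier2001, §1.2 Conjecture 1] -/
theorem kontsevichZagierPeriods_of_pieces' (h₁ : SpVolumeArcLifting) (h₂ : SpTameNoBlowUp)
    (h₃ : SpTameUniformClosure) : KontsevichZagierPeriods :=
  kzPeriodConjecture'_iff_isRational.mp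
    (KZ.kzPeriodConjecture'_of_volumeConjectureCompact KZ.semiCanonicalReduction_holds
      (volumeConjectureCompact_of_pieces' h₁ h₂ h₃))

/-- **Item stmt-KontsevichZagierPeriods-18037 `SpArcLiftingOfPieces`, proved**: the split glue
`SpVolumeArcLifting → SpTameNoBlowUp → SpTameUniformClosure → SpArcLifting`, through the summit
(`kontsevichZagierPeriods_of_pieces'`) and constant typed arcs (`spArcLifting_of_summit`).
[cite: KontsevichZagier2001, §1.2 Conjecture 1] [cite: CressonViusos2022, §1 p. 326] -/
theorem spArcLiftingOfPieces_proof : SpArcLiftingOfPieces :=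
  fun h₁ h₂ h₃ => spArcLifting_of_summit (kontsevichZagierPeriods_of_pieces' h₁ h₂ h₃)

end Summit.KontsevichZagierPeriods.StandardParts
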